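import Summits.ValiantsHypothesis.ValiantsHypothesis.Theorems.BarrierLeverPartitionMinorsHitByVPSamePatternAll

/-!
# Route BarrierLever — item `PartitionMinorsHitByVP` (stmt-ValiantsHypothesis-19717):
# the Frobenius door with a RELABELED DIGIT ORDER (the table `Y_a^{p^{π c}}`)

Helper file (`--supports stmt-ValiantsHypothesis-19717`; cell valiant-natproofs, rung V4, 𝒟-side door (c); prover
seat val-np-p6 gen 6). Definition-free. Closes NO item.

The characteristic-`p` Frobenius door (`…FrobeniusDoorCharP`, val-np-p6 g5) uses the Moore table `Y_a^{p^c}`: column digit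
`c` gets the exponent `p^c`. Nothing forces this ORDER of the digits: the table `Y_a^{p^{π c}}` for a permutation `π` of
`Fin h` is just as admissible, and its matrix is the `π`-relabeled column family's Moore matrix. Since the low-order peel
of this seat reads the digits in exponent order, the freedom of `π` is exactly the freedom to choose the ORDER in which the
column coordinates are peeled (seat memo RESIDUE-v8: jointly peelable pairs with a free digit order are 1 727 / 2 591 of
the labelled lower-set pairs at `h = 4`, against 1 619 for the fixed order).

* **`partitionMinor_hit_of_frobenius_char_digitPerm`** — `h ≥ 2`; if for SOME prime `p` and SOME permutation `π` of the
  digits `det [η_{u i}^{Σ_{c ∈ w j} p^{π c}}] ≠ 0` in `𝔽_p[Y]`, the layout `(u, w)` is hit inside `SmallCircuits ℂ (h+h) 5`.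

So the conjecture of record of the T1 line may be weakened to F_*': «for every ball-row layout SOME prime and SOME digit
order certify». WHAT THIS IS NOT: no new unconditional class by itself; nothing on crux 14610 or VP vs VNP.
-/

set_option linter.dupNamespace false

namespace Summit.ValiantsHypothesis.ValiantsHypothesis.Theorems.BarrierLever.FrobeniusDoor

open Finset MvPolynomial Matrix
open Literature.Barriers.ValiantsHypothesis

noncomputable section

/-- **Frobenius door, relabeled digit order.** `h ≥ 2`; a nonzero Moore determinant for the table `Y_a^{p^{π c}}`
(any prime `p`, any permutation `π` of the column coordinates) hits the layout inside `SmallCircuits ℂ (h+h) 5`. -/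
theorem partitionMinor_hit_of_frobenius_char_digitPerm (p : ℕ) [Fact p.Prime] {h r : ℕ} (hh : 2 ≤ h)
    (π : Equiv.Perm (Fin h)) (u w : Fin r → Finset (Fin h))
    (hF : (Matrix.of fun i j : Fin r =>
      ((X none + ∑ a ∈ u i, X (some a) : MvPolynomial (Option (Fin h)) (ZMod p))) ^
        (∑ c ∈ w j, p ^ ((π c : Fin h) : ℕ))).det ≠ 0) :
    ∃ f ∈ SmallCircuits ℂ (h + h) 5,
      (Matrix.of fun i j : Fin r => MvPolynomial.coeff
        (∑ a ∈ u i, Finsupp.single (Fin.castAdd h a) 1 +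
          ∑ c ∈ w j, Finsupp.single (Fin.natAdd h c) 1) f).det ≠ 0 := by
  -- the matrix is the Moore matrix of the relabeled column family `j ↦ (w j).map π`
  have hF' : (Matrix.of fun i j : Fin r =>
      ((X none + ∑ a ∈ u i, X (some a) : MvPolynomial (Option (Fin h)) (ZMod p))) ^
        (∑ c ∈ (w j).map π.toEmbedding, p ^ (c : ℕ))).det ≠ 0 := by
    have hmat : (Matrix.of fun i j : Fin r =>
        ((X none + ∑ a ∈ u i, X (some a) : MvPolynomial (Option (Fin h)) (ZMod p))) ^
          (∑ c ∈ (w j).map π.toEmbedding, p ^ (c : ℕ))) =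
        Matrix.of fun i j : Fin r =>
          ((X none + ∑ a ∈ u i, X (some a) : MvPolynomial (Option (Fin h)) (ZMod p))) ^
            (∑ c ∈ w j, p ^ ((π c : Fin h) : ℕ)) := by
      refine Matrix.ext fun i j => ?_
      rw [Matrix.of_apply, Matrix.of_apply, Finset.sum_map]
      rfl
    rw [hmat]; exact hF
  exact partitionMinor_hit_of_relabel_cols π u w (partitionMinor_hit_of_frobenius_char p hh u _ hF')

end

end Summit.ValiantsHypothesis.ValiantsHypothesis.Theorems.BarrierLever.FrobeniusDoor
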